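import Summits.HodgeConjecture.HodgeConjecture.Theses.HolomorphicityRate
import Literature.Geometry.Kaehler.AnalyticSetSingularLocusCodim
import Literature.Geometry.Kaehler.AnalyticSetComponentsProofs
import Literature.Geometry.Kaehler.NearlyHolomorphicCycleSupport
import Literature.NumberTheory.Transcendental.ComplexFormsPullback
import Literature.AlgebraicGeometry.HodgeTheory.AnalyticSupport
import Literature.AlgebraicGeometry.HodgeTheory.SupportedClassesHodgeConiveauHolds
import Summits.HodgeConjecture.HodgeConjecture.Theorems.HolomorphicityRateSuperThresholdRigidityKerLeOfEqOnZeroSet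
import Summits.HodgeConjecture.HodgeConjecture.Theorems.HolomorphicityRateSuperThresholdRigidityEventuallySurjectiveFderiv
import Summits.HodgeConjecture.HodgeConjecture.Theorems.HolomorphicityRateSuperThresholdRigidityIsRegPtOfContDiffOnComplexKer
import Summits.HodgeConjecture.HodgeConjecture.Theorems.HolomorphicityRateSuperThresholdRigidityAnalyticOfRegularOffBad
import Summits.HodgeConjecture.HodgeConjecture.Theorems.HolomorphicityRateSuperThresholdRigidityGoodPointRegular
import Summits.HodgeConjecture.HodgeConjecture.Theorems.HolomorphicityRateSuperThresholdRigidityHolomorphicSupport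
import Summits.HodgeConjecture.HodgeConjecture.Theorems.HolomorphicityRateRateGapOfHodge
import Summits.HodgeConjecture.HodgeConjecture.Theorems.HolomorphicityRateThresholdForcesHodgeTypeOfTilt
import Summits.HodgeConjecture.HodgeConjecture.Theorems.HolomorphicityRateSuperThresholdRigidityRationalThomLine
import Summits.HodgeConjecture.HodgeConjecture.Theorems.HolomorphicityRateSuperThresholdRigidityAnalyticSupportOfAlgebraic
import Summits.HodgeConjecture.HodgeConjecture.Theorems.HolomorphicityRateSuperThresholdRigidityHolomorphicSupportOfAnalytic
import HarnessLib.Audit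

/-!
# Crux `SuperThresholdRigidity` (item stmt-HodgeConjecture-2737, route HolomorphicityRate) — skeleton `birth`,
# RESHAPED by lead c2 (v7): the rational Thom line, GAGA supports, and the Hodge core

Skeleton of line `registered` for R2 of the card "Hodge as a rate": the crux
`Summit.HodgeConjecture.HodgeConjecture.Theses.HolomorphicityRate.SuperThresholdRigidity` is concluded BY
NAME by `SuperThresholdRigidity_of (hE2 : ThresholdForcesHodgeType)` (E2 = route support item
stmt-HodgeConjecture-10764, admissible hypothesis by name) — unchanged since the birth skeleton.

## What changed in v6 (lead c2, 2026-08-17)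

Leads 0/c1 closed the recognition half (`stub_holomorphicSupportIsAnalytic`, 7 landed Theorems files) and the
edge codimensions, leaving ONE registered stub, `stub_newtonBelowThreshold_mid` (`0 < p < n`), read as the
"Newton–Kuranishi basin" and handed back as crux-sized. v6 observes that its CONCLUSION does not need a
Newton scheme: once `c` is of type `(p,p)` (the stub's hypothesis, supplied by E2 in the assembly),

1. (`stub_rationalThomLine`, A) the classes of `H²ᵖ(X(ℂ); ℂ)` dying off a nearly holomorphic cycle
   support `S` of codimension `p ≥ 1` lie on a line spanned by a RATIONAL class `r` dying off `S` — the
   tree's line theorem `IsNearlyHolomorphicCycleSupport.exists_ker_map_compl_le_span` (landed for E2) plus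
   rational descent of kernels of restriction maps (`mem_span_isRationalClass_of_map_eq_zero`,
   `span_isRationalClass_eq_top_of_isSmoothProjective_holds`); provable now, size M;
2. so `γ_k = m•c + a_k•hp = e • r`; if `γ_k = 0` the empty support carries it; otherwise `r = e⁻¹ γ_k` is a
   rational class of type `(p,p)` (`hp` is `(p,p)` by `Grothendieck1969_supportedClasses_le_hodgeConiveau_holds`),
   hence ALGEBRAIC by the Hodge conjecture in codimension `p` on `X`: in the tree for `p = 1`
   (`lefschetzOneOne_rational_holds`), `p = n`, and `n/2 < p < n` by hard Lefschetz
   (`HardLefschetzNFold.mem_algebraicClasses_of_lt_holds`) down to `n - p`; the residue `2 ≤ p ≤ n/2` is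
   `stub_hodgeBelowMiddle` (C) — VERBATIM the open stub of the sister crux `RateGap`
   (`Cruxes/RateGap/Lines/birth.lean`), i.e. the summit in that range (composition through the landed
   `Theorems.mem_algebraicClasses_of_hodgeBelowMiddle`);
3. (`stub_analyticSupportOfAlgebraic`, B1) algebraic classes are analytically supported in codimension `≥ p`
   on every Hodge model (GAGA: `isAnalyticSet_preimage_setOf_pt_mem`, `le_regularLocus_codim_of_le_coheight`,
   `map_compl_pullback_eq_zero_of_restrictCompl_eq_zero`); provable now, size S–M;
4. (`stub_holomorphicSupportOfAnalytic`, B2) a closed analytic subset all of whose regular points have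
   codimension `≥ p` carries the holomorphic-support clause of the stub (bad set `Sg = S ∖ reg_p S`, inside
   `T = sng S ∪ ⋃_{q > p} cl(reg_q S)`, analytic of codimension `≥ p + 1` by `isAnalyticSet_singularLocus_holds`,
   `IsAnalyticSet.succ_le_codim_singularLocus`, `hasPureCodim_closure_regularLocusOfCodim_holds`; good points by
   the realification of holomorphic submersions, cf. `IsRegularPointOfCodim.isNearlyHolomorphicRegularPoint`);
   provable now, size M.

`stub_newtonBelowThreshold_mid` is now sorry-free GLUE over A, B1, B2 (LANDED p149559 p150425 p151374) and C (for
EVERY `k`, with no use of the defect profile). Consequences recorded honestly: granted E2, the crux R2 holds outright for `p ∈ {0, 1, n-1, n}`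
(so for all `n ≤ 3`) once A, B1, B2 land, and in general R2 ⟸ E2 ∧ HC-at-or-below-the-middle — the same
residual core as R1 (`rateGap_of_hodgeBelowMiddle`); jointly R1 ∧ R2 ⟹ HC (`closes`). The "rate" mechanism is
not forced by either crux as filed.

## Assembly (unchanged)

`SuperThresholdRigidity_of (hE2)`: `t_k := C'·k^{-(p+δ)}`, `t_k·k^p = C'·k^{-δ} → 0`, E2 ⟹ Hodge type,
`stub_newtonBelowThreshold` (edge `p ∈ {0,n}` automatic + mid) ⟹ eventual correction, `Frequently.and_eventually`
picks `k`, `stub_holomorphicSupportIsAnalytic` recognises. `sorry` occurs only inside `stub_hodgeBelowMiddle` (C).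

Disproof used: none on file for this crux (no `Cruxes/SuperThresholdRigidity/Disproof.lean`, no landed
`Negative/` lemma) — 2026-08-17.
-/

set_option linter.dupNamespace false

noncomputable section

namespace Summit.HodgeConjecture.HodgeConjecture.Cruxes.SuperThresholdRigidity.Birth

open scoped Manifold Topology
open Summit.HodgeConjecture.HodgeConjecture.Theses.HolomorphicityRate

/-- **Newton stub, edge codimensions `p = 0` and `p = n` (automatic).** For a Hodge model `A` of an
`n`-dimensional smooth projective `X` (so `dim_ℂ A.model = n`) and `p = 0` or `p = n`, every support `(S, Sg)`
satisfying the route's nearly-holomorphic clause with ANY defect already satisfies the holomorphic-support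
clause: at `x ∈ S ∖ Sg` keep the given `U`, `f`; if `p = 0` the target `Fin 0 → ℝ` is a subsingleton, and if
`p = n` the onto differential `df_x : T_x ≅ ℝ^{2n} → ℝ^{2n}` is one-to-one
(`LinearMap.injective_iff_surjective_of_finrank_eq_finrank`, `finrank_real_of_complex`,
`IsAnalytification.finrank_eq`), so `df_x v = 0` forces `v = 0`. All other clauses, and the vanishing of the
ray class off `S`, are copied. LANDED verbatim as `Summit.HodgeConjecture.HodgeConjecture.Theorems.stub_newtonBelowThreshold_edge`
(p147113, `Theorems/HolomorphicityRateSuperThresholdRigidityNewtonEdge.lean`); inlined here so that this workfile elaborates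
independently of that module's build state. [folklore] -/
theorem newtonBelowThreshold_edge : ∀ (n p : ℕ) (X : Literature.AlgebraicGeometry.Motives.SchemeOver ℂ), Literature.AlgebraicGeometry.Motives.IsSmoothProjective n X → p ≤ n → (p = 0 ∨ p = n) → ∀ (A : Literature.AlgebraicGeometry.HodgeTheory.HodgeModel n X) (g : Bundle.ContMDiffRiemannianMetric 𝓘(ℝ, A.model) ((⊤ : ℕ∞) : WithTop ℕ∞) A.model (fun x : A.carrier => TangentSpace 𝓘(ℝ, A.model) x)) (c hp : Literature.AlgebraicGeometry.HodgeTheory.complexBetti X (2 * p)) (m : ℕ) (C : ℝ) (a : ℕ → ℕ) (t : ℕ → ℝ), Literature.AlgebraicGeometry.HodgeTheory.IsRationalClass hp → hp ∈ Literature.AlgebraicGeometry.HodgeTheory.algebraicClasses X p → 0 < m → (∀ k, (a k : ℝ) ≤ C * (k : ℝ) ^ p) → Filter.Tendsto (fun k : ℕ => t k * (k : ℝ) ^ p) Filter.atTop (nhds 0) → A.pullback (2 * p) c ∈ A.hodgePQ (2 * p) p p → ∀ᶠ k : ℕ in Filter.atTop, (∃ S Sg : Set A.carrier, (IsClosed S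 ∧ IsClosed Sg ∧ Sg ⊆ S ∧ IsConnected (S \ Sg) ∧ (∀ x ∈ Sg, Literature.Geometry.Kaehler.IsAnalyticSetAt 𝓘(ℂ, A.model) S x) ∧ (∃ T : Set A.carrier, Sg ⊆ T ∧ (Literature.Geometry.Kaehler.IsAnalyticSet 𝓘(ℂ, A.model) T ∧ ∀ x ∈ Literature.Geometry.Kaehler.regularLocus 𝓘(ℂ, A.model) T, ∀ q : ℕ, Literature.Geometry.Kaehler.IsRegularPointOfCodim 𝓘(ℂ, A.model) T q x → p + 1 ≤ q)) ∧ (∀ x ∈ S \ Sg, ∃ U : Set A.carrier, IsOpen U ∧ x ∈ U ∧ ∃ f : A.carrier → (Fin (2 * p) → ℝ), ContMDiffOn 𝓘(ℝ, A.model) 𝓘(ℝ, Fin (2 * p) → ℝ) 1 f U ∧ S ∩ U = U ∩ f ⁻¹' {0} ∧ Function.Surjective (mfderiv 𝓘(ℝ, A.model) 𝓘(ℝ, Fin (2 * p) → ℝ) f x) ∧ ∀ v : TangentSpace 𝓘(ℝ, A.model) x, mfderiv 𝓘(ℝ, A.model) 𝓘(ℝ, Fin (2 * p) → ℝ) f x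 v = 0 → ∃ w : TangentSpace 𝓘(ℝ, A.model) x, mfderiv 𝓘(ℝ, A.model) 𝓘(ℝ, Fin (2 * p) → ℝ) f x w = 0 ∧ g.inner x (Literature.Geometry.Kaehler.tangentJ A.model x v - w) (Literature.Geometry.Kaehler.tangentJ A.model x v - w) ≤ (t k) ^ 2 * g.inner x v v)) ∧ Literature.AlgebraicTopology.SingularHomology.singularCohomology.map ℂ ℂ (⟨Subtype.val, continuous_subtype_val⟩ : C({x : A.carrier // x ∉ S}, A.carrier)) (2 * p) (A.pullback (2 * p) (((m : ℂ) • c + ((a k : ℕ) : ℂ) • hp))) = 0) → ∃ S Sg : Set A.carrier, (IsClosed S ∧ IsClosed Sg ∧ Sg ⊆ S ∧ (∀ x ∈ Sg, Literature.Geometry.Kaehler.IsAnalyticSetAt 𝓘(ℂ, A.model) S x) ∧ (∃ T : Set A.carrier, Sg ⊆ T ∧ (Literature.Geometry.Kaehler.IsAnalyticSet 𝓘(ℂ, A.model) T ∧ ∀ x ∈ Literature.Geometry.Kaehler.regularLocus 𝓘(ℂ, A.model) T, ∀ q : ℕ, Literature.Geometry.Kaehler.IsRegularPointOfCodim 𝓘(ℂ,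 A.model) T q x → p + 1 ≤ q)) ∧ (∀ x ∈ S \ Sg, ∃ U : Set A.carrier, IsOpen U ∧ x ∈ U ∧ ∃ f : A.carrier → (Fin (2 * p) → ℝ), ContMDiffOn 𝓘(ℝ, A.model) 𝓘(ℝ, Fin (2 * p) → ℝ) 1 f U ∧ S ∩ U = U ∩ f ⁻¹' {0} ∧ Function.Surjective (mfderiv 𝓘(ℝ, A.model) 𝓘(ℝ, Fin (2 * p) → ℝ) f x) ∧ ∀ v : TangentSpace 𝓘(ℝ, A.model) x, mfderiv 𝓘(ℝ, A.model) 𝓘(ℝ, Fin (2 * p) → ℝ) f x v = 0 → mfderiv 𝓘(ℝ, A.model) 𝓘(ℝ, Fin (2 * p) → ℝ) f x (Literature.Geometry.Kaehler.tangentJ A.model x v) = 0)) ∧ Literature.AlgebraicTopology.SingularHomology.singularCohomology.map ℂ ℂ (⟨Subtype.val, continuous_subtype_val⟩ : C({x : A.carrier // x ∉ S}, A.carrier)) (2 * p) (A.pullback (2 * p) (((m : ℂ) • c + ((a k : ℕ) : ℂ) • hp))) = 0 := by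
  intro n p X _hX _hpn hedge A g c hp m C a t _hrat _halg _hm _hbud _ht _hH
  refine Filter.Eventually.of_forall fun k => ?_
  rintro ⟨S, Sg, ⟨hS, hSg, hsub, -, han, hT, hreg⟩, hsupp⟩
  refine ⟨S, Sg, ⟨hS, hSg, hsub, han, hT, fun x hx => ?_⟩, hsupp⟩
  obtain ⟨U, hU, hxU, f, hf, hSU, hsurj, -⟩ := hreg x hx
  refine ⟨U, hU, hxU, f, hf, hSU, hsurj, fun v hv => ?_⟩
  rcases hedge with h0 | hn
  · -- `p = 0`: the target `Fin 0 → ℝ` is trivial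
    subst h0
    exact funext fun i => absurd i.2 (by omega)
  · -- `p = n`: an onto linear map `ℝ^{2n} ≅ T_x → ℝ^{2n}` is one-to-one, so `v = 0`
    set L := mfderiv 𝓘(ℝ, A.model) 𝓘(ℝ, Fin (2 * p) → ℝ) f x with hL
    have hdim : Module.finrank ℝ (TangentSpace 𝓘(ℝ, A.model) x) =
        Module.finrank ℝ (Fin (2 * p) → ℝ) := by
      change Module.finrank ℝ A.model = _
      rw [finrank_real_of_complex, A.isAnalytification.finrank_eq, Module.finrank_fin_fun, hn]
    have hinj : Function.Injective L.toLinearMap :=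
      (LinearMap.injective_iff_surjective_of_finrank_eq_finrank hdim).2 hsurj
    have hv0 : v = 0 := hinj (by rw [ContinuousLinearMap.coe_coe, hv, map_zero])
    rw [hv0, map_zero, map_zero]

/-! ### Stubs A, B1, B2 — LANDED (lead c2 wave 1, 2026-08-17, all `--supports stmt-HodgeConjecture-2737`)

* `Summit.HodgeConjecture.HodgeConjecture.Theorems.stub_rationalThomLine` — p149559,
  `Theorems/HolomorphicityRateSuperThresholdRigidityRationalThomLine.lean` (rational Thom line of a nearly
  holomorphic cycle support: the kernel of `γ ↦ (A^*γ)|_{X^an ∖ S}` is spanned by a RATIONAL class of the kernel);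
* `Summit.HodgeConjecture.HodgeConjecture.Theorems.stub_analyticSupportOfAlgebraic` — p150425,
  `Theorems/HolomorphicityRateSuperThresholdRigidityAnalyticSupportOfAlgebraic.lean` (GAGA: algebraic classes are
  analytically supported in codimension `≥ p` on every Hodge model, every `p`);
* `Summit.HodgeConjecture.HodgeConjecture.Theorems.stub_holomorphicSupportOfAnalytic` — p151374,
  `Theorems/HolomorphicityRateSuperThresholdRigidityHolomorphicSupportOfAnalytic.lean` (structure theory: a closed
  analytic subset with regular points of codimension `≥ p` satisfies the crux's holomorphic-support clause).

They are imported above and used BY NAME in the glue `stub_newtonBelowThreshold_mid`. -/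

/-- **Stub C — the Hodge core at or below the middle (`2 ≤ p ≤ n/2`).** Rational `(p,p)`-classes on a
smooth projective `n`-fold are algebraic for `2 ≤ p` and `2p ≤ n`: VERBATIM the open stub `stub_hodgeBelowMiddle`
of the sister crux `RateGap` (`Cruxes/RateGap/Lines/birth.lean`), i.e. the summit in the range the tree does
not prove (`p = 1` is `lefschetzOneOne_rational_holds`, `p = n` is `mem_algebraicClasses_of_degree_top`,
`n/2 < p < n` reduces to `n - p` by `HardLefschetzNFold.mem_algebraicClasses_of_lt_holds`; composition
`Theorems.mem_algebraicClasses_of_hodgeBelowMiddle`). Open problem (Deligne 2000); NOT a worker target — it is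
registered so that the skeleton states honestly what the crux still owes once A, B1, B2 land: R2 ⟸ E2 ∧ C.
[cite: Deligne2000, §1] [cite: KerrPearlstein2011, §3.1] -/
theorem stub_hodgeBelowMiddle : ∀ (n p : ℕ) (X : Literature.AlgebraicGeometry.Motives.SchemeOver ℂ), Literature.AlgebraicGeometry.Motives.IsSmoothProjective n X → 2 ≤ p → 2 * p ≤ n → ∀ (A : Literature.AlgebraicGeometry.HodgeTheory.HodgeModel n X) (c : Literature.AlgebraicGeometry.HodgeTheory.complexBetti X (2 * p)), Literature.AlgebraicGeometry.HodgeTheory.IsRationalClass c → A.pullback (2 * p) c ∈ A.hodgePQ (2 * p) p p → c ∈ Literature.AlgebraicGeometry.HodgeTheory.algebraicClasses X p := by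
  sorry

/-- **`stub_newtonBelowThreshold_mid` (`0 < p < n`) — now GLUE (v6).** The statement registered by lead c1
(the "Newton–Kuranishi basin at the E2 scale" restricted to the middle codimensions), proved for EVERY `k` and
without the defect profile from stubs A, B1, B2, C: a ray class `γ_k = m•c + a_k•hp` dying off a nearly
holomorphic cycle support is `e • r` with `r` rational dying off the same support (A); if `γ_k = 0` the empty
support is a holomorphic support carrying it; otherwise `r = e⁻¹ γ_k` is of type `(p,p)` (`c` by hypothesis,
`hp` by `Grothendieck1969_supportedClasses_le_hodgeConiveau_holds` through
`Theorems.pullback_mem_hodgePQ_of_mem_algebraicClasses`) and rational, hence algebraic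
(`Theorems.mem_algebraicClasses_of_hodgeBelowMiddle` over C), so `γ_k` is algebraic, hence analytically
supported (B1) on an analytic set which is a holomorphic support (B2). [cite: VoisinHodgeI2002, §11.1.2 and §11.3]
[cite: SerreGAGA1956, §2 n°5] -/
theorem stub_newtonBelowThreshold_mid : ∀ (n p : ℕ) (X : Literature.AlgebraicGeometry.Motives.SchemeOver ℂ), Literature.AlgebraicGeometry.Motives.IsSmoothProjective n X → p ≤ n → 0 < p → p < n → ∀ (A : Literature.AlgebraicGeometry.HodgeTheory.HodgeModel n X) (g : Bundle.ContMDiffRiemannianMetric 𝓘(ℝ, A.model) ((⊤ : ℕ∞) : WithTop ℕ∞) A.model (fun x : A.carrier => TangentSpace 𝓘(ℝ, A.model) x)) (c hp : Literature.AlgebraicGeometry.HodgeTheory.complexBetti X (2 * p)) (m : ℕ) (C : ℝ) (a : ℕ → ℕ) (t : ℕ → ℝ), Literature.AlgebraicGeometry.HodgeTheory.IsRationalClass hp → hp ∈ Literature.AlgebraicGeometry.HodgeTheory.algebraicClasses X p → 0 < m → (∀ k, (a k : ℝ) ≤ C * (k : ℝ) ^ p) → Filter.Tendsto (fun k : ℕ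 => t k * (k : ℝ) ^ p) Filter.atTop (nhds 0) → A.pullback (2 * p) c ∈ A.hodgePQ (2 * p) p p → ∀ᶠ k : ℕ in Filter.atTop, (∃ S Sg : Set A.carrier, (IsClosed S ∧ IsClosed Sg ∧ Sg ⊆ S ∧ IsConnected (S \ Sg) ∧ (∀ x ∈ Sg, Literature.Geometry.Kaehler.IsAnalyticSetAt 𝓘(ℂ, A.model) S x) ∧ (∃ T : Set A.carrier, Sg ⊆ T ∧ (Literature.Geometry.Kaehler.IsAnalyticSet 𝓘(ℂ, A.model) T ∧ ∀ x ∈ Literature.Geometry.Kaehler.regularLocus 𝓘(ℂ, A.model) T, ∀ q : ℕ, Literature.Geometry.Kaehler.IsRegularPointOfCodim 𝓘(ℂ, A.model) T q x → p + 1 ≤ q)) ∧ (∀ x ∈ S \ Sg, ∃ U : Set A.carrier, IsOpen U ∧ x ∈ U ∧ ∃ f : A.carrier → (Fin (2 * p) → ℝ), ContMDiffOn 𝓘(ℝ, A.model) 𝓘(ℝ, Fin (2 * p) → ℝ) 1 f U ∧ S ∩ U = U ∩ f ⁻¹' {0} ∧ Function.Surjective (mfderiv 𝓘(ℝ, A.model)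 𝓘(ℝ, Fin (2 * p) → ℝ) f x) ∧ ∀ v : TangentSpace 𝓘(ℝ, A.model) x, mfderiv 𝓘(ℝ, A.model) 𝓘(ℝ, Fin (2 * p) → ℝ) f x v = 0 → ∃ w : TangentSpace 𝓘(ℝ, A.model) x, mfderiv 𝓘(ℝ, A.model) 𝓘(ℝ, Fin (2 * p) → ℝ) f x w = 0 ∧ g.inner x (Literature.Geometry.Kaehler.tangentJ A.model x v - w) (Literature.Geometry.Kaehler.tangentJ A.model x v - w) ≤ (t k) ^ 2 * g.inner x v v)) ∧ Literature.AlgebraicTopology.SingularHomology.singularCohomology.map ℂ ℂ (⟨Subtype.val, continuous_subtype_val⟩ : C({x : A.carrier // x ∉ S}, A.carrier)) (2 * p) (A.pullback (2 * p) (((m : ℂ) • c + ((a k : ℕ) : ℂ) • hp))) = 0) → ∃ S Sg : Set A.carrier, (IsClosed S ∧ IsClosed Sg ∧ Sg ⊆ S ∧ (∀ x ∈ Sg, Literature.Geometry.Kaehler.IsAnalyticSetAt 𝓘(ℂ, A.model) S x) ∧ (∃ T : Set A.carrier, Sg ⊆ T ∧ (Literature.Geometry.Kaehler.IsAnalyticSet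 𝓘(ℂ, A.model) T ∧ ∀ x ∈ Literature.Geometry.Kaehler.regularLocus 𝓘(ℂ, A.model) T, ∀ q : ℕ, Literature.Geometry.Kaehler.IsRegularPointOfCodim 𝓘(ℂ, A.model) T q x → p + 1 ≤ q)) ∧ (∀ x ∈ S \ Sg, ∃ U : Set A.carrier, IsOpen U ∧ x ∈ U ∧ ∃ f : A.carrier → (Fin (2 * p) → ℝ), ContMDiffOn 𝓘(ℝ, A.model) 𝓘(ℝ, Fin (2 * p) → ℝ) 1 f U ∧ S ∩ U = U ∩ f ⁻¹' {0} ∧ Function.Surjective (mfderiv 𝓘(ℝ, A.model) 𝓘(ℝ, Fin (2 * p) → ℝ) f x) ∧ ∀ v : TangentSpace 𝓘(ℝ, A.model) x, mfderiv 𝓘(ℝ, A.model) 𝓘(ℝ, Fin (2 * p) → ℝ) f x v = 0 → mfderiv 𝓘(ℝ, A.model) 𝓘(ℝ, Fin (2 * p) → ℝ) f x (Literature.Geometry.Kaehler.tangentJ A.model x v) = 0)) ∧ Literature.AlgebraicTopology.SingularHomology.singularCohomology.map ℂ ℂ (⟨Subtype.val, continuous_subtype_val⟩ : C({x : A.carrier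 // x ∉ S}, A.carrier)) (2 * p) (A.pullback (2 * p) (((m : ℂ) • c + ((a k : ℕ) : ℂ) • hp))) = 0 := by
  intro n p X hX hpn hp0 _hpn' A g c hp m C a t hrat halg _hm _hbud _ht hH
  refine Filter.Eventually.of_forall fun k => ?_
  rintro ⟨S, Sg, hS, hsupp⟩
  -- the route's inline clause is the tree predicate `IsNearlyHolomorphicCycleSupport`, by `Iff.rfl`
  have hS' : Literature.Geometry.Kaehler.IsNearlyHolomorphicCycleSupport g.toRiemannianMetric p (t k) S Sg :=
    (Literature.Geometry.Kaehler.isNearlyHolomorphicCycleSupport_toRiemannianMetric_iff g).2 hS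
  -- (A) the rational Thom line of `S`: `γ_k = e • r` with `r` rational and dying off `S`
  obtain ⟨r, hrat_r, _hr0, hline⟩ := Summit.HodgeConjecture.HodgeConjecture.Theorems.stub_rationalThomLine n X hX A g p (t k) S Sg hp0 hS'
  obtain ⟨e, he⟩ := hline _ hsupp
  by_cases hγ : ((m : ℂ) • c + ((a k : ℕ) : ℂ) • hp) = 0
  · -- the ray class vanishes: the empty (holomorphic) support carries it
    refine ⟨∅, ∅, ⟨isClosed_empty, isClosed_empty, Set.empty_subset _, fun x hx => hx.elim,
      ⟨∅, Set.empty_subset _, Literature.Geometry.Kaehler.isAnalyticSet_empty, fun x hx => ?_⟩,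
      fun x hx => hx.1.elim⟩, ?_⟩
    · exact ((Literature.Geometry.Kaehler.regularLocus_subset (I := 𝓘(ℂ, A.model)) (∅ : Set A.carrier)) hx).elim
    · rw [hγ, map_zero, map_zero]
  · -- `e ≠ 0`, so `r = e⁻¹ • γ_k` is of type `(p,p)` (E2 input `hH` for `c`, Grothendieck for `hp`);
    -- `r` is rational, hence ALGEBRAIC by the Hodge conjecture in codimension `p` (Lefschetz `(1,1)`,
    -- top degree and hard Lefschetz in the tree; stub C at or below the middle), and so is `γ_k`
    have he0 : e ≠ 0 := by
      rintro rfl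
      rw [zero_smul] at he
      exact hγ he
    have hG := Literature.AlgebraicGeometry.HodgeTheory.Grothendieck1969_supportedClasses_le_hodgeConiveau_holds
    have hγpp : A.pullback (2 * p) ((m : ℂ) • c + ((a k : ℕ) : ℂ) • hp) ∈ A.hodgePQ (2 * p) p p := by
      rw [map_add, map_smul, map_smul]
      exact Submodule.add_mem _ (Submodule.smul_mem _ _ hH)
        (Submodule.smul_mem _ _
          (Summit.HodgeConjecture.HodgeConjecture.Theorems.pullback_mem_hodgePQ_of_mem_algebraicClasses
            hG hX A halg))
    have hrpp : A.pullback (2 * p) r ∈ A.hodgePQ (2 * p) p p := by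
      have h1 : r = e⁻¹ • ((m : ℂ) • c + ((a k : ℕ) : ℂ) • hp) := by
        rw [he, smul_smul, inv_mul_cancel₀ he0, one_smul]
      rw [h1, map_smul]
      exact Submodule.smul_mem _ _ hγpp
    have hralg : r ∈ Literature.AlgebraicGeometry.HodgeTheory.algebraicClasses X p :=
      Summit.HodgeConjecture.HodgeConjecture.Theorems.mem_algebraicClasses_of_hodgeBelowMiddle
        stub_hodgeBelowMiddle hX hpn hp0 A r hrat_r hrpp
    have hγalg : ((m : ℂ) • c + ((a k : ℕ) : ℂ) • hp) ∈
        Literature.AlgebraicGeometry.HodgeTheory.algebraicClasses X p := by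
      rw [he]
      exact Submodule.smul_mem _ _ hralg
    -- (B1) algebraic classes are analytically supported; (B2) analytic supports are holomorphic supports
    obtain ⟨S', ⟨hS'an, hS'codim⟩, hS'supp⟩ := Summit.HodgeConjecture.HodgeConjecture.Theorems.stub_analyticSupportOfAlgebraic n p X hX A _ hγalg
    obtain ⟨Sg', hhol⟩ := Summit.HodgeConjecture.HodgeConjecture.Theorems.stub_holomorphicSupportOfAnalytic n X A p S' hS'an hS'codim
    exact ⟨S', Sg', hhol, hS'supp⟩

/-- **Stub 1 (Newton–Kuranishi basin at the E2 scale).** For `X` smooth projective of dimension `n`,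
`p ≤ n`, a Hodge model `A`, a smooth metric `g`, classes `c hp` with `hp` rational algebraic, `m ≥ 1`,
a budget `a_k ≤ C·k^p`, a defect profile `t` with `t_k·k^p → 0`, and `c` OF TYPE `(p,p)` in `A`:
for all large `k`, if the ray class `m•c + a_k•hp` is supported on a connected nearly-holomorphic cycle
support of defect `≤ t_k` (the route's inlined clause, verbatim), then it is supported on a closed set `S`
which, off a closed `Sg ⊆ S` (near which `S` is analytic, `Sg` inside a closed analytic set of codimension
`≥ p+1`), is a `C¹` submanifold of real codimension `2p` with `J`-invariant tangent planes.
Intended proof: Newton iteration on normal graphs over `S_k` in `(X, kω)` (Hörmander `L²` / Serre vanishing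
as the tame estimate, quadratic error `∝ θ²`, obstruction = off-type periods of `γ_k`, zero since `c` is
`(p,p)`), limit recognised by Federer–Fleming compactness. [HanLi2005, ArezzoSun2015, Donaldson1996,
King1971]
Now GLUE: case split into `stub_newtonBelowThreshold_edge` (`p = 0 ∨ p = n`, automatic) and
`stub_newtonBelowThreshold_mid` (`0 < p < n`, the open content). -/
theorem stub_newtonBelowThreshold : ∀ (n p : ℕ) (X : Literature.AlgebraicGeometry.Motives.SchemeOver ℂ), Literature.AlgebraicGeometry.Motives.IsSmoothProjective n X → p ≤ n → ∀ (A : Literature.AlgebraicGeometry.HodgeTheory.HodgeModel n X) (g : Bundle.ContMDiffRiemannianMetric 𝓘(ℝ, A.model) ((⊤ : ℕ∞) : WithTop ℕ∞) A.model (fun x : A.carrier => TangentSpace 𝓘(ℝ, A.model) x)) (c hp : Literature.AlgebraicGeometry.HodgeTheory.complexBetti X (2 * p)) (m : ℕ) (C : ℝ) (a : ℕ → ℕ) (t : ℕ → ℝ), Literature.AlgebraicGeometry.HodgeTheory.IsRationalClass hp → hp ∈ Literature.AlgebraicGeometry.HodgeTheory.algebraicClasses X p → 0 < m → (∀ k,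 (a k : ℝ) ≤ C * (k : ℝ) ^ p) → Filter.Tendsto (fun k : ℕ => t k * (k : ℝ) ^ p) Filter.atTop (nhds 0) → A.pullback (2 * p) c ∈ A.hodgePQ (2 * p) p p → ∀ᶠ k : ℕ in Filter.atTop, (∃ S Sg : Set A.carrier, (IsClosed S ∧ IsClosed Sg ∧ Sg ⊆ S ∧ IsConnected (S \ Sg) ∧ (∀ x ∈ Sg, Literature.Geometry.Kaehler.IsAnalyticSetAt 𝓘(ℂ, A.model) S x) ∧ (∃ T : Set A.carrier, Sg ⊆ T ∧ (Literature.Geometry.Kaehler.IsAnalyticSet 𝓘(ℂ, A.model) T ∧ ∀ x ∈ Literature.Geometry.Kaehler.regularLocus 𝓘(ℂ, A.model) T, ∀ q : ℕ, Literature.Geometry.Kaehler.IsRegularPointOfCodim 𝓘(ℂ, A.model) T q x → p + 1 ≤ q)) ∧ (∀ x ∈ S \ Sg, ∃ U : Set A.carrier, IsOpen U ∧ x ∈ U ∧ ∃ f : A.carrier → (Fin (2 * p) → ℝ), ContMDiffOn 𝓘(ℝ, A.model) 𝓘(ℝ, Fin (2 * p) → ℝ) 1 f U ∧ S ∩ U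 = U ∩ f ⁻¹' {0} ∧ Function.Surjective (mfderiv 𝓘(ℝ, A.model) 𝓘(ℝ, Fin (2 * p) → ℝ) f x) ∧ ∀ v : TangentSpace 𝓘(ℝ, A.model) x, mfderiv 𝓘(ℝ, A.model) 𝓘(ℝ, Fin (2 * p) → ℝ) f x v = 0 → ∃ w : TangentSpace 𝓘(ℝ, A.model) x, mfderiv 𝓘(ℝ, A.model) 𝓘(ℝ, Fin (2 * p) → ℝ) f x w = 0 ∧ g.inner x (Literature.Geometry.Kaehler.tangentJ A.model x v - w) (Literature.Geometry.Kaehler.tangentJ A.model x v - w) ≤ (t k) ^ 2 * g.inner x v v)) ∧ Literature.AlgebraicTopology.SingularHomology.singularCohomology.map ℂ ℂ (⟨Subtype.val, continuous_subtype_val⟩ : C({x : A.carrier // x ∉ S}, A.carrier)) (2 * p) (A.pullback (2 * p) (((m : ℂ) • c + ((a k : ℕ) : ℂ) • hp))) = 0) → ∃ S Sg : Set A.carrier, (IsClosed S ∧ IsClosed Sg ∧ Sg ⊆ S ∧ (∀ x ∈ Sg, Literature.Geometry.Kaehler.IsAnalyticSetAt 𝓘(ℂ, A.model) S x) ∧ (∃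 T : Set A.carrier, Sg ⊆ T ∧ (Literature.Geometry.Kaehler.IsAnalyticSet 𝓘(ℂ, A.model) T ∧ ∀ x ∈ Literature.Geometry.Kaehler.regularLocus 𝓘(ℂ, A.model) T, ∀ q : ℕ, Literature.Geometry.Kaehler.IsRegularPointOfCodim 𝓘(ℂ, A.model) T q x → p + 1 ≤ q)) ∧ (∀ x ∈ S \ Sg, ∃ U : Set A.carrier, IsOpen U ∧ x ∈ U ∧ ∃ f : A.carrier → (Fin (2 * p) → ℝ), ContMDiffOn 𝓘(ℝ, A.model) 𝓘(ℝ, Fin (2 * p) → ℝ) 1 f U ∧ S ∩ U = U ∩ f ⁻¹' {0} ∧ Function.Surjective (mfderiv 𝓘(ℝ, A.model) 𝓘(ℝ, Fin (2 * p) → ℝ) f x) ∧ ∀ v : TangentSpace 𝓘(ℝ, A.model) x, mfderiv 𝓘(ℝ, A.model) 𝓘(ℝ, Fin (2 * p) → ℝ) f x v = 0 → mfderiv 𝓘(ℝ, A.model) 𝓘(ℝ, Fin (2 * p) → ℝ) f x (Literature.Geometry.Kaehler.tangentJ A.model x v) = 0)) ∧ Literature.AlgebraicTopology.SingularHomology.singularCohomology.map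 ℂ ℂ (⟨Subtype.val, continuous_subtype_val⟩ : C({x : A.carrier // x ∉ S}, A.carrier)) (2 * p) (A.pullback (2 * p) (((m : ℂ) • c + ((a k : ℕ) : ℂ) • hp))) = 0 := by
  intro n p X hX hpn
  by_cases h : p = 0 ∨ p = n
  · exact newtonBelowThreshold_edge n p X hX hpn h
  · push Not at h
    exact stub_newtonBelowThreshold_mid n p X hX hpn (Nat.pos_of_ne_zero h.1) (lt_of_le_of_ne hpn h.2)

/-! ### Status (lead c2, skeleton v6, 2026-08-17)

Stubs A `stub_rationalThomLine` (p149559), B1 `stub_analyticSupportOfAlgebraic` (p150425), B2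
`stub_holomorphicSupportOfAnalytic` (p151374) LANDED in wave 1; the ONE open registered stub is `stub_hodgeBelowMiddle`
(C, the summit for `2 ≤ p ≤ n/2`, shared verbatim with crux `RateGap`). Everything else is kernel-checked glue:
`newtonBelowThreshold_edge` (landed p147113), `stub_newtonBelowThreshold_mid`, `stub_newtonBelowThreshold`,
`stub_holomorphicSupportIsAnalytic` (landed p145778 with its pieces p143616 p143621 p144203 p143781 p144925),
`SuperThresholdRigidity_of`. -/

/-- **Recognition of holomorphic supports (the planner's stub 2, signature verbatim; now glue).** On the carrier
of any Hodge model `A`: a closed `S` which, off a closed `Sg ⊆ S` near which `S` is analytic and which lies in a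
closed analytic set all of whose regular points have codimension `≥ p + 1`, is locally the zero set of a real `C¹`
submersion `f : X^an → ℝ^{2p}` with `J`-invariant kernel at the base point, is a closed ANALYTIC subset of `X^an`
all of whose regular points have codimension `≥ p`. Composition of `stub_goodPointRegular` (good points are
regular of codimension `p`) and `stub_analyticOfRegularOffBad` (dimension theory at the bad set).
[King1971, HarveyShiffman1974, GriffithsHarrisPrinciples1978 Ch. 0 §2, Chirka1989 §2] -/
theorem stub_holomorphicSupportIsAnalytic : ∀ (n : ℕ) (X : Literature.AlgebraicGeometry.Motives.SchemeOver ℂ) (A : Literature.AlgebraicGeometry.HodgeTheory.HodgeModel n X) (p : ℕ) (S Sg : Set A.carrier), (IsClosed S ∧ IsClosed Sg ∧ Sg ⊆ S ∧ (∀ x ∈ Sg, Literature.Geometry.Kaehler.IsAnalyticSetAt 𝓘(ℂ, A.model) S x) ∧ (∃ T : Set A.carrier, Sg ⊆ T ∧ (Literature.Geometry.Kaehler.IsAnalyticSet 𝓘(ℂ, A.model) T ∧ ∀ x ∈ Literature.Geometry.Kaehler.regularLocus 𝓘(ℂ, A.model) T, ∀ q : ℕ, Literature.Geometry.Kaehler.IsRegularPointOfCodim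 𝓘(ℂ, A.model) T q x → p + 1 ≤ q)) ∧ (∀ x ∈ S \ Sg, ∃ U : Set A.carrier, IsOpen U ∧ x ∈ U ∧ ∃ f : A.carrier → (Fin (2 * p) → ℝ), ContMDiffOn 𝓘(ℝ, A.model) 𝓘(ℝ, Fin (2 * p) → ℝ) 1 f U ∧ S ∩ U = U ∩ f ⁻¹' {0} ∧ Function.Surjective (mfderiv 𝓘(ℝ, A.model) 𝓘(ℝ, Fin (2 * p) → ℝ) f x) ∧ ∀ v : TangentSpace 𝓘(ℝ, A.model) x, mfderiv 𝓘(ℝ, A.model) 𝓘(ℝ, Fin (2 * p) → ℝ) f x v = 0 → mfderiv 𝓘(ℝ, A.model) 𝓘(ℝ, Fin (2 * p) → ℝ) f x (Literature.Geometry.Kaehler.tangentJ A.model x v) = 0)) → (Literature.Geometry.Kaehler.IsAnalyticSet 𝓘(ℂ, A.model) S ∧ ∀ x ∈ Literature.Geometry.Kaehler.regularLocus 𝓘(ℂ, A.model) S, ∀ q : ℕ, Literature.Geometry.Kaehler.IsRegularPointOfCodim 𝓘(ℂ, A.model) S q x → p ≤ q) := by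
  rintro n X A p S Sg ⟨hS, hSg, hsub, han, hT, hgood⟩
  exact Summit.HodgeConjecture.HodgeConjecture.Theorems.stub_analyticOfRegularOffBad hS hSg hsub han hT
    (Summit.HodgeConjecture.HodgeConjecture.Theorems.stub_goodPointRegular hSg hgood)

/-- **Assembly (kernel-checked, no `sorry` of its own).** The crux `SuperThresholdRigidity` BY NAME from
the route's threshold lemma E2 (`ThresholdForcesHodgeType`, item stmt-HodgeConjecture-10764, admissible
hypothesis by name) and the two stubs above: with the crux's defect profile `t_k := C'·k^{-(p+δ)}` one
has `t_k·k^p = C'·k^{-δ} → 0`, so E2 makes `c` of type `(p,p)`; the Newton stub then corrects, for all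
large `k`, every super-threshold representative of `m•c + a_k•hp`; `Frequently.and_eventually` picks one
`k` at which the crux hypothesis supplies such a representative; the recognition stub identifies the
corrected support as a closed analytic subset with regular points of codimension `≥ p`. -/
theorem SuperThresholdRigidity_of (hE2 : ThresholdForcesHodgeType) : SuperThresholdRigidity := by
  intro n p X hX hpn A g c hp m C a δ C' hrat halg hm hbud hδ hfreq
  -- the defect profile of the crux and its rate: `t_k · k^p = C' · k^{-δ} → 0`
  have htend : Filter.Tendsto (fun k : ℕ => C' * (k : ℝ) ^ (-((p : ℝ) + δ)) * (k : ℝ) ^ p)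
      Filter.atTop (nhds 0) := by
    have h1 : Filter.Tendsto (fun k : ℕ => C' * (k : ℝ) ^ (-δ)) Filter.atTop (nhds 0) := by
      have h0 := ((tendsto_rpow_neg_atTop hδ).comp tendsto_natCast_atTop_atTop).const_mul C'
      simpa using h0
    refine h1.congr' ?_
    filter_upwards [Filter.eventually_gt_atTop 0] with k hk
    have hk' : (k : ℝ) ≠ 0 := Nat.cast_ne_zero.2 (Nat.pos_iff_ne_zero.1 hk)
    have e : (k : ℝ) ^ (-((p : ℝ) + δ)) * (k : ℝ) ^ p = (k : ℝ) ^ (-δ) := by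
      rw [← Real.rpow_add_natCast hk', show -((p : ℝ) + δ) + (p : ℕ) = -δ by ring]
    simp only [mul_assoc, e]
  -- E2: super-threshold representatives for infinitely many `k` force the Hodge type of `c`
  have hH : A.pullback (2 * p) c ∈ A.hodgePQ (2 * p) p p :=
    hE2 n p X hX hpn A g c hp m C a (fun k : ℕ => C' * (k : ℝ) ^ (-((p : ℝ) + δ)))
      hrat halg hm hbud htend hfreq
  -- Newton–Kuranishi below the threshold: eventually every such representative is correctable
  have hev := stub_newtonBelowThreshold n p X hX hpn A g c hp m C a
    (fun k : ℕ => C' * (k : ℝ) ^ (-((p : ℝ) + δ))) hrat halg hm hbud htend hH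
  -- one `k` carrying both a super-threshold representative and its correction
  obtain ⟨k, hk, hcorr⟩ := (hfreq.and_eventually hev).exists
  obtain ⟨S, Sg, hhol, hsupp⟩ := hcorr hk
  -- recognition: the corrected support is a closed analytic subset with regular points of codim ≥ p
  exact ⟨k, S, stub_holomorphicSupportIsAnalytic n X A p S Sg hhol, hsupp⟩

end Summit.HodgeConjecture.HodgeConjecture.Cruxes.SuperThresholdRigidity.Birth

end
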